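import Literature.MathematicalPhysics.QuantumFieldTheory.Balaban1983to89.B9Eq34CovCurlVector

/-!
# `Balaban1983to89.B9Eq371BondPrincipalTwoBackgroundSplit` — T. Bałaban, *Propagators for lattice gauge theories in a background field*, Commun. Math. Phys. **99** (1985)
# 389–434 [Balaban1985BackgroundPropagators] (3.71)–(3.73) p. 405 (*«D*_{U′U}D_{U′U}A′ = (D*DA′) − (V₁(A)A′) … The operator V₁ satisfies
# |(V₁(A)A′)(b)| ≤ O(1)(|∇A||A′| + |A|²|A′|) + O(1)|A|(|∇A′| + …) … The constant O(1) is an absolute constant depending on d only»*), with (3.4) p. 391, (3.9)–(3.10)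
# p. 392, (3.35) p. 396: **THE FIRST-ORDER (LEIBNIZ) SPLIT OF THE PRINCIPAL PART `D*D` OF THE BOND HESSIAN BETWEEN TWO BACKGROUNDS, POINTWISE** — for ABSTRACT
# transporter data `R(b)`, `S(b)` on the fibre with `‖R(b)w − w‖, ‖S(b)w − w‖ ≤ ε‖w‖` and the nearest-neighbour variation `‖R(x,μ)w − R(x−e_λ,μ)w‖ ≤ ε′‖w‖`:
# `‖((D*_SD_R − D*_1D_1)A)(y,κ)‖ ≤ 4N_q·[(‖c‖²ε² + ‖c‖²ε′)·M₀ + 2‖c‖ε·M₁]`, `M₀` a bound of `A` and `M₁` a bound of the FLAT gradient `∇_1A` over the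
# 2-neighbourhood of `y`, `N_q = #{μ < ν}` — on the model (`c = η⁻¹`, `ε = O(αη)`, `ε′ = O(αη²)`) every coefficient is `O(α)`: print's `V₁(A)` «is a local differential
# operator of the first order» with small coefficients, the cancellation that makes the two-background perturbation of the bond propagator `G = Δ_a⁻¹` tractable ((3.84)–(3.86) p. 407)

statement-level skeleton of published theorems with citation tags; proofs where landed; nothing here is a claim about the Yang–Mills mass gap

CITATION HEADER (lean-in-tree rule).  Audit cell `pub-balaban`, sub-cell `t4`, BINDER row NE9; NE9 crux-team LEAF PROVER 01 (`b2b-balaban-t4-ne9-formalise-leaf-01`, gen 100;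
bears_on: R4/N22) — brick G-1 of the bond-propagator storey (J′-G) of the lineage's two-background ladder programme (memo `t4/b2b-balaban-t4-ne9-formalise-leaf-01/g99/ROUTE-Jprime-LOCATED-g99.md`).
Vocabulary BY NAME: the OWNER's `B9Eq34CovCurlVector.covCurl` ∕ `covCoCurl` ∕ `covLapPrincipal` ((3.4), (3.9), `D*D`), `B9Eq33CovDerivVector.covGrad` ((3.3) on bond functions),
`B9SectCLatticeCarrier.{shift, unshift, Bond, Plaq, DirPair}`.  The SITE analogue (divergence-form split of `Δ^η_U − Δ^η_1`) is this lineage's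
`B9Eq342CovariantResolventAdjointRowLetters` §Split (gen 93); here the derivative is moved to the RIGHT (Leibniz), because the consumer composes with the bond
propagator's VALUE and GRADIENT rows on the right (`B9Eq326G1kSupRowClosed`, `B9Eq326G1kSliceGradRowClosed`) — adjoint letters would cost the block volume.
Sources: [Balaban1985BackgroundPropagators] pp. 391–392, 396, 405, 407 (text layer pp. 3–4, 8, 17, 19 read by this lineage 2026-08-28).  Print obtains (3.73) from
the analytic expansion `R(U′) = exp(ηi ad A)`; the cell's real two-background version below is [folklore] finite-difference algebra; NOTHING of print's proof is reproduced.

WHAT IS PROVED (sorry-free; proof lane — no `def`).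
* §1 `shift_unshift_comm`; the pointwise formulas `covCurl_sub_flat_apply` (`q := D_RA − D_1A`, no derivative of `A`), `covCoCurl_sub_flat_apply`; their sizes
  `norm_covCurl_sub_flat_apply_le` (`≤ ‖c‖ε(‖A‖ + ‖A‖)`), `norm_covCoCurl_sub_flat_apply_le`.
* §2 the Leibniz step: `q_unshift_sub_q_eq` (`q(p − e_λ) − q(p)` = transporter VARIATION × value + (transporter − 1) × FLAT GRADIENT, the `c`'s cancelling),
  `norm_q_unshift_sub_q_le` (`≤ ‖c‖ε′(‖A‖ + ‖A‖) + ε(‖∇_1A‖ + ‖∇_1A‖)`), `norm_covCoCurl_apply_le_leibniz` (`D*_S` of ANY plaquette function by the Leibniz rearrangement).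
* §3 **`covLapPrincipal_sub_flat_eq`** (`D*_SD_R − D*_1D_1 = D*_S(D_R − D_1) + (D*_S − D*_1)D_1`) and **`norm_covLapPrincipal_sub_flat_apply_le`** — the bound of the title.
HONEST SCOPE.  Pointwise finite-difference bookkeeping for abstract transporters; no propagator, no decay, no constant of print valued; the curvature term `Δ′` of (3.10) and the
`DRD*`, `Q*aQ` members of `Δ_a` ((3.74)–(3.83)) are NOT here (next bricks).  NE9 NOT PRINTED ∕ NOT PROVED; spine PROVED 0∕9; rung (B)+1 finite T⁴ — NOT infinite volume, NOT mass gap,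
NOT BetaPertH, NOT Clay.  HONEST DEPENDENCY: continuum YM on T⁴ ⇐ BetaPertH ∧ nine spine estimates (0/9 proved); BetaPertH ⇐ (D1) ∧ (D4) ∧ CAP+tail; G-an2-4 gates asym, D1 and
NE2/3/4.  NEW file; nothing modified.  Net new unproved facts: 0.
-/

noncomputable section

open scoped BigOperators

namespace Literature.MathematicalPhysics.QuantumFieldTheory.Balaban1983to89.B9Eq371BondPrincipalTwoBackgroundSplit

open B4Sect5Torus (TSite)
open B9SectCLatticeCarrier (Bond Plaq DirPair bpos btgt shift unshift shift_unshift unshift_shift shift_eq_iff)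
open B9Eq33CovDerivVector (covGrad covGrad_apply_dir)
open B9Eq34CovCurlVector (covCurl covCoCurl covLapPrincipal covCurl_apply_coord covCoCurl_apply covLapPrincipal_apply shift_comm)

variable {d : ℕ} {P : Fin d → ℕ} {W : Type*} [NormedAddCommGroup W] [NormedSpace ℂ W]

/-! ## §1 The two zeroth-order differences -/

/-- `(x − e_ν) + e_μ = (x + e_μ) − e_ν` on the periodic lattice. [folklore] [cite: Balaban1985BackgroundPropagators, (3.4) p.391] -/
theorem shift_unshift_comm (μ ν : Fin d) (x : TSite d P) : shift μ (unshift ν x) = unshift ν (shift μ x) := by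
  rw [← shift_eq_iff]
  rw [shift_comm, shift_unshift]

section Split

variable (c : ℂ) (R S : Bond d P → W →ₗ[ℂ] W)

/-- **`(D_RA − D_1A)(p_{μν}(x)) = c•((R(x,μ) − 1)A(x+e_μ, ν) − (R(x,ν) − 1)A(x+e_ν, μ))`** — the values of `A` at the base `x` CANCEL ((3.4) with `R` against (3.4) with `1`).
[folklore] [cite: Balaban1985BackgroundPropagators, (3.4) p.391, (3.71) p.405] -/
theorem covCurl_sub_flat_apply (A : Bond d P → W) (x : TSite d P) (q : DirPair d) :
    covCurl c R A (x, q) - covCurl c (fun _ : Bond d P => (LinearMap.id : W →ₗ[ℂ] W)) A (x, q) =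
      c • ((R (x, q.1.1) (A (shift q.1.1 x, q.1.2)) - A (shift q.1.1 x, q.1.2)) - (R (x, q.1.2) (A (shift q.1.2 x, q.1.1)) - A (shift q.1.2 x, q.1.1))) := by
  rw [covCurl_apply_coord, covCurl_apply_coord]
  simp only [LinearMap.id_coe, id_eq, smul_sub]
  abel

/-- **`‖(D_RA − D_1A)(p_{μν}(x))‖ ≤ ‖c‖·ε·(‖A(x+e_μ, ν)‖ + ‖A(x+e_ν, μ)‖)`** when `‖R(b)w − w‖ ≤ ε‖w‖`. [folklore] [cite: Balaban1985BackgroundPropagators, (3.71) p.405, (3.35) p.396] -/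
theorem norm_covCurl_sub_flat_apply_le {ε : ℝ} (hRε : ∀ b w, ‖R b w - w‖ ≤ ε * ‖w‖) (A : Bond d P → W) (x : TSite d P) (q : DirPair d) :
    ‖covCurl c R A (x, q) - covCurl c (fun _ : Bond d P => (LinearMap.id : W →ₗ[ℂ] W)) A (x, q)‖ ≤
      ‖c‖ * (ε * (‖A (shift q.1.1 x, q.1.2)‖ + ‖A (shift q.1.2 x, q.1.1)‖)) := by
  rw [covCurl_sub_flat_apply, norm_smul, mul_add]
  exact mul_le_mul_of_nonneg_left ((norm_sub_le _ _).trans (add_le_add (hRε _ _) (hRε _ _))) (norm_nonneg c)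

/-- **`(D*_SG − D*_1G)_κ(y) = c•(Σ_{ν<κ… } (S − 1)G − Σ (S − 1)G)`** — (3.9) with `S` against (3.9) with `1`: the values of `G` at the plaquettes through `y` CANCEL.
[folklore] [cite: Balaban1985BackgroundPropagators, (3.9) p.392, (3.71) p.405] -/
theorem covCoCurl_sub_flat_apply (G : Plaq d P → W) (y : TSite d P) (κ : Fin d) :
    covCoCurl c S G (y, κ) - covCoCurl c (fun _ : Bond d P => (LinearMap.id : W →ₗ[ℂ] W)) G (y, κ) =
      c • ((∑ q ∈ Finset.univ.filter (fun q : DirPair d => q.1.2 = κ),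
          (S (unshift q.1.1 y, q.1.1) (G (unshift q.1.1 y, q)) - G (unshift q.1.1 y, q))) -
        ∑ q ∈ Finset.univ.filter (fun q : DirPair d => q.1.1 = κ),
          (S (unshift q.1.2 y, q.1.2) (G (unshift q.1.2 y, q)) - G (unshift q.1.2 y, q))) := by
  rw [covCoCurl_apply, covCoCurl_apply, ← smul_sub]
  congr 1
  simp only [LinearMap.id_coe, id_eq]
  rw [sub_sub_sub_comm, ← Finset.sum_sub_distrib, ← Finset.sum_sub_distrib]
  congr 1 <;> exact Finset.sum_congr rfl fun q _ => by abel

/-- A filtered sum of nonnegative terms is at most the full sum. [folklore] [cite: Balaban1985BackgroundPropagators, (3.9) p.392] -/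
private theorem sum_filter_le_sum {ι : Type*} [Fintype ι] (p : ι → Prop) [DecidablePred p] {f : ι → ℝ} (hf : ∀ i, 0 ≤ f i) :
    ∑ i ∈ Finset.univ.filter p, f i ≤ ∑ i, f i :=
  Finset.sum_le_sum_of_subset_of_nonneg (Finset.filter_subset _ _) fun i _ _ => hf i

/-- **`‖(D*_SG − D*_1G)_κ(y)‖ ≤ ‖c‖·ε·Σ_{q}(‖G(p_q(y − e_{q₁}))‖ + ‖G(p_q(y − e_{q₂}))‖)`** (both filtered sums majorised by the full sum over the direction pairs) when
`‖S(b)w − w‖ ≤ ε‖w‖`. [folklore] [cite: Balaban1985BackgroundPropagators, (3.9) p.392, (3.71) p.405, (3.35) p.396] -/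
theorem norm_covCoCurl_sub_flat_apply_le {ε : ℝ} (hSε : ∀ b w, ‖S b w - w‖ ≤ ε * ‖w‖) (hε : 0 ≤ ε) (G : Plaq d P → W) (y : TSite d P) (κ : Fin d) :
    ‖covCoCurl c S G (y, κ) - covCoCurl c (fun _ : Bond d P => (LinearMap.id : W →ₗ[ℂ] W)) G (y, κ)‖ ≤
      ‖c‖ * (ε * ∑ q : DirPair d, (‖G (unshift q.1.1 y, q)‖ + ‖G (unshift q.1.2 y, q)‖)) := by
  classical
  rw [covCoCurl_sub_flat_apply, norm_smul]
  refine mul_le_mul_of_nonneg_left ((norm_sub_le _ _).trans ?_) (norm_nonneg c)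
  have h1 : ‖∑ q ∈ Finset.univ.filter (fun q : DirPair d => q.1.2 = κ), (S (unshift q.1.1 y, q.1.1) (G (unshift q.1.1 y, q)) - G (unshift q.1.1 y, q))‖ ≤
      ∑ q : DirPair d, ε * ‖G (unshift q.1.1 y, q)‖ :=
    (norm_sum_le _ _).trans ((Finset.sum_le_sum fun q _ => hSε _ _).trans
      (sum_filter_le_sum _ fun q => mul_nonneg hε (norm_nonneg _)))
  have h2 : ‖∑ q ∈ Finset.univ.filter (fun q : DirPair d => q.1.1 = κ), (S (unshift q.1.2 y, q.1.2) (G (unshift q.1.2 y, q)) - G (unshift q.1.2 y, q))‖ ≤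
      ∑ q : DirPair d, ε * ‖G (unshift q.1.2 y, q)‖ :=
    (norm_sum_le _ _).trans ((Finset.sum_le_sum fun q _ => hSε _ _).trans
      (sum_filter_le_sum _ fun q => mul_nonneg hε (norm_nonneg _)))
  refine (add_le_add h1 h2).trans (le_of_eq ?_)
  rw [Finset.mul_sum, ← Finset.sum_add_distrib]
  exact Finset.sum_congr rfl fun q _ => by ring

/-! ## §2 The Leibniz step for `D*_S(D_R − D_1)` -/

/-- **THE DIFFERENCE OF `q = D_RA − D_1A` AT TWO NEIGHBOURING PLAQUETTES** `p_{μν}(y − e_λ)` and `p_{μν}(y)` (`c ≠ 0`): transporter VARIATION times value, plus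
(transporter − 1) times the FLAT backward gradient in direction `λ` — `A((y−e_λ)+e_μ, ν) − A(y+e_μ, ν) = −c⁻¹•(∇_1A)(((y−e_λ)+e_μ, λ), ν)` since `((y−e_λ)+e_μ)+e_λ = y+e_μ`.
[folklore] [cite: Balaban1985BackgroundPropagators, (3.71)–(3.73) p.405, (3.3)–(3.4) p.391] -/
theorem q_unshift_sub_q_eq (hc : c ≠ 0) (A : Bond d P → W) (y : TSite d P) (lam : Fin d) (q : DirPair d) :
    (covCurl c R A (unshift lam y, q) - covCurl c (fun _ : Bond d P => (LinearMap.id : W →ₗ[ℂ] W)) A (unshift lam y, q)) -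
        (covCurl c R A (y, q) - covCurl c (fun _ : Bond d P => (LinearMap.id : W →ₗ[ℂ] W)) A (y, q)) =
      c • (((R (unshift lam y, q.1.1) (A (shift q.1.1 (unshift lam y), q.1.2)) - R (y, q.1.1) (A (shift q.1.1 (unshift lam y), q.1.2))) -
            c⁻¹ • (R (y, q.1.1) (covGrad c (fun _ : Bond d P => (LinearMap.id : W →ₗ[ℂ] W)) A ((shift q.1.1 (unshift lam y), lam), q.1.2)) -
              covGrad c (fun _ : Bond d P => (LinearMap.id : W →ₗ[ℂ] W)) A ((shift q.1.1 (unshift lam y), lam), q.1.2))) -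
          ((R (unshift lam y, q.1.2) (A (shift q.1.2 (unshift lam y), q.1.1)) - R (y, q.1.2) (A (shift q.1.2 (unshift lam y), q.1.1))) -
            c⁻¹ • (R (y, q.1.2) (covGrad c (fun _ : Bond d P => (LinearMap.id : W →ₗ[ℂ] W)) A ((shift q.1.2 (unshift lam y), lam), q.1.1)) -
              covGrad c (fun _ : Bond d P => (LinearMap.id : W →ₗ[ℂ] W)) A ((shift q.1.2 (unshift lam y), lam), q.1.1)))) := by
  rw [covCurl_sub_flat_apply, covCurl_sub_flat_apply, ← smul_sub]
  congr 1
  have hs : ∀ μ : Fin d, shift lam (shift μ (unshift lam y)) = shift μ y := fun μ => by rw [shift_comm, shift_unshift]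
  simp only [covGrad_apply_dir, LinearMap.id_coe, id_eq, hs, map_smul, map_sub, smul_sub, smul_smul, inv_mul_cancel₀ hc, one_smul]
  abel

/-- **SIZE OF THE LEIBNIZ STEP**:
`‖q(p_{μν}(y−e_λ)) − q(p_{μν}(y))‖ ≤ ‖c‖·ε′·(‖A((y−e_λ)+e_μ,ν)‖ + ‖A((y−e_λ)+e_ν,μ)‖) + ε·(‖(∇_1A)(((y−e_λ)+e_μ,λ),ν)‖ + ‖(∇_1A)(((y−e_λ)+e_ν,λ),μ)‖)` from the variation
`‖R(x−e_λ,μ)w − R(x,μ)w‖ ≤ ε′‖w‖` and `‖R(b)w − w‖ ≤ ε‖w‖` (the `c`'s cancel in the gradient term: `‖c‖·‖c⁻¹‖ = 1`). [folklore] [cite: Balaban1985BackgroundPropagators, (3.73) p.405, (3.35) p.396] -/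
theorem norm_q_unshift_sub_q_le (hc : c ≠ 0) {ε ε' : ℝ} (hRε : ∀ b w, ‖R b w - w‖ ≤ ε * ‖w‖)
    (hRε' : ∀ (x : TSite d P) (lam μ : Fin d) (w : W), ‖R (unshift lam x, μ) w - R (x, μ) w‖ ≤ ε' * ‖w‖)
    (A : Bond d P → W) (y : TSite d P) (lam : Fin d) (q : DirPair d) :
    ‖(covCurl c R A (unshift lam y, q) - covCurl c (fun _ : Bond d P => (LinearMap.id : W →ₗ[ℂ] W)) A (unshift lam y, q)) -
        (covCurl c R A (y, q) - covCurl c (fun _ : Bond d P => (LinearMap.id : W →ₗ[ℂ] W)) A (y, q))‖ ≤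
      ‖c‖ * (ε' * (‖A (shift q.1.1 (unshift lam y), q.1.2)‖ + ‖A (shift q.1.2 (unshift lam y), q.1.1)‖)) +
        ε * (‖covGrad c (fun _ : Bond d P => (LinearMap.id : W →ₗ[ℂ] W)) A ((shift q.1.1 (unshift lam y), lam), q.1.2)‖ +
          ‖covGrad c (fun _ : Bond d P => (LinearMap.id : W →ₗ[ℂ] W)) A ((shift q.1.2 (unshift lam y), lam), q.1.1)‖) := by
  rw [q_unshift_sub_q_eq c R hc, norm_smul]
  have hc0 : 0 < ‖c‖ := norm_pos_iff.mpr hc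
  -- the two kinds of terms
  have hvar : ∀ (μ ν : Fin d), ‖R (unshift lam y, μ) (A (shift μ (unshift lam y), ν)) - R (y, μ) (A (shift μ (unshift lam y), ν))‖ ≤
      ε' * ‖A (shift μ (unshift lam y), ν)‖ := fun μ ν => hRε' _ _ _ _
  have hgr : ∀ (μ : Fin d) (g : W), ‖c⁻¹ • (R (y, μ) g - g)‖ ≤ ‖c‖⁻¹ * (ε * ‖g‖) := fun μ g => by
    rw [norm_smul, norm_inv]
    exact mul_le_mul_of_nonneg_left (hRε _ _) (inv_nonneg.mpr (norm_nonneg c))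
  set g₁ := covGrad c (fun _ : Bond d P => (LinearMap.id : W →ₗ[ℂ] W)) A ((shift q.1.1 (unshift lam y), lam), q.1.2)
  set g₂ := covGrad c (fun _ : Bond d P => (LinearMap.id : W →ₗ[ℂ] W)) A ((shift q.1.2 (unshift lam y), lam), q.1.1)
  have h := (norm_sub_le _ _).trans (add_le_add
    ((norm_sub_le _ _).trans (add_le_add (hvar q.1.1 q.1.2) (hgr q.1.1 g₁)))
    ((norm_sub_le _ _).trans (add_le_add (hvar q.1.2 q.1.1) (hgr q.1.2 g₂))))
  refine (mul_le_mul_of_nonneg_left h (norm_nonneg c)).trans (le_of_eq ?_)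
  field_simp
  ring

/-- **`‖(D*_S q)_κ(y)‖` BY THE LEIBNIZ STEP**: writing each summand of (3.9) as `S(b′)q(p′) − q(p) = (S(b′) − 1)q(p′) + (q(p′) − q(p))`,
`‖(D*_Sq)_κ(y)‖ ≤ ‖c‖·Σ_q[(ε‖q(p_q(y−e_{q₁}))‖ + ‖q(p_q(y−e_{q₁})) − q(p_q(y))‖) + (the same with q₂)]` for ANY plaquette function `q`, `‖S(b)w − w‖ ≤ ε‖w‖`.
[folklore] [cite: Balaban1985BackgroundPropagators, (3.9) p.392, (3.71)–(3.73) p.405] -/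
theorem norm_covCoCurl_apply_le_leibniz {ε : ℝ} (hSε : ∀ b w, ‖S b w - w‖ ≤ ε * ‖w‖) (hε : 0 ≤ ε) (G : Plaq d P → W) (y : TSite d P) (κ : Fin d) :
    ‖covCoCurl c S G (y, κ)‖ ≤
      ‖c‖ * ∑ q : DirPair d, ((ε * ‖G (unshift q.1.1 y, q)‖ + ‖G (unshift q.1.1 y, q) - G (y, q)‖) +
        (ε * ‖G (unshift q.1.2 y, q)‖ + ‖G (unshift q.1.2 y, q) - G (y, q)‖)) := by
  classical
  rw [covCoCurl_apply, norm_smul]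
  refine mul_le_mul_of_nonneg_left ((norm_sub_le _ _).trans ?_) (norm_nonneg c)
  have key : ∀ (b : Bond d P) (u v : W), ‖S b u - v‖ ≤ ε * ‖u‖ + ‖u - v‖ := fun b u v => by
    calc ‖S b u - v‖ = ‖(S b u - u) + (u - v)‖ := by rw [sub_add_sub_cancel]
      _ ≤ ‖S b u - u‖ + ‖u - v‖ := norm_add_le _ _
      _ ≤ ε * ‖u‖ + ‖u - v‖ := add_le_add (hSε _ _) le_rfl
  have h1 : ‖∑ q ∈ Finset.univ.filter (fun q : DirPair d => q.1.2 = κ), (S (unshift q.1.1 y, q.1.1) (G (unshift q.1.1 y, q)) - G (y, q))‖ ≤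
      ∑ q : DirPair d, (ε * ‖G (unshift q.1.1 y, q)‖ + ‖G (unshift q.1.1 y, q) - G (y, q)‖) :=
    (norm_sum_le _ _).trans ((Finset.sum_le_sum fun q _ => key _ _ _).trans
      (sum_filter_le_sum _ fun q => by positivity))
  have h2 : ‖∑ q ∈ Finset.univ.filter (fun q : DirPair d => q.1.1 = κ), (S (unshift q.1.2 y, q.1.2) (G (unshift q.1.2 y, q)) - G (y, q))‖ ≤
      ∑ q : DirPair d, (ε * ‖G (unshift q.1.2 y, q)‖ + ‖G (unshift q.1.2 y, q) - G (y, q)‖) :=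
    (norm_sum_le _ _).trans ((Finset.sum_le_sum fun q _ => key _ _ _).trans
      (sum_filter_le_sum _ fun q => by positivity))
  exact (add_le_add h1 h2).trans (le_of_eq Finset.sum_add_distrib.symm)

/-! ## §3 The split and the bound -/

/-- **`D*_SD_R − D*_1D_1 = D*_S(D_R − D_1) + (D*_S − D*_1)D_1`** (pointwise). [folklore] [cite: Balaban1985BackgroundPropagators, (3.71) p.405, (3.10) p.392] -/
theorem covLapPrincipal_sub_flat_eq (A : Bond d P → W) (b : Bond d P) :
    covLapPrincipal c R S A b - covLapPrincipal c (fun _ : Bond d P => (LinearMap.id : W →ₗ[ℂ] W)) (fun _ => LinearMap.id) A b =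
      covCoCurl c S (covCurl c R A - covCurl c (fun _ : Bond d P => (LinearMap.id : W →ₗ[ℂ] W)) A) b +
        (covCoCurl c S (covCurl c (fun _ : Bond d P => (LinearMap.id : W →ₗ[ℂ] W)) A) b -
          covCoCurl c (fun _ : Bond d P => (LinearMap.id : W →ₗ[ℂ] W)) (covCurl c (fun _ : Bond d P => (LinearMap.id : W →ₗ[ℂ] W)) A) b) := by
  rw [covLapPrincipal_apply, covLapPrincipal_apply, map_sub, Pi.sub_apply]
  abel

/-- **THE FIRST-ORDER BOUND (3.73) BETWEEN TWO BACKGROUNDS, POINTWISE** — for `c ≠ 0`, transporters with `‖R(b)w − w‖, ‖S(b)w − w‖ ≤ ε‖w‖` (`ε ≥ 0`) and the variation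
`‖R(x−e_λ,μ)w − R(x,μ)w‖ ≤ ε′‖w‖`, a bond function `A` with `‖A(x′,ν)‖ ≤ M₀` at the sites `x′ = (y−e_λ)+e_μ` (all `λ, μ`; `λ = μ` gives `y`) and FLAT gradients
`‖(∇_1A)((y−e_λ,μ),ν)‖ ≤ M₁`, `‖(∇_1A)(((y−e_λ)+e_μ,λ),ν)‖ ≤ M₁` (the values `A(y+e_μ,ν)` and the gradients at `y` itself CANCEL and are not needed):
`‖((D*_SD_RA) − (D*_1D_1A))(y,κ)‖ ≤ 4N_q·((‖c‖²ε² + ‖c‖²ε′)·M₀ + 2‖c‖ε·M₁)`, `N_q = #DirPair d` — every coefficient `O(α)` on the model (`‖c‖ε = O(α)`, `‖c‖²ε′ = O(α)`).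
[cite: Balaban1985BackgroundPropagators, (3.71)–(3.73) p.405, (3.35) p.396, (3.84)–(3.85) p.407] -/
theorem norm_covLapPrincipal_sub_flat_apply_le (hc : c ≠ 0) {ε ε' M₀ M₁ : ℝ} (hε : 0 ≤ ε) (hε' : 0 ≤ ε')
    (hRε : ∀ b w, ‖R b w - w‖ ≤ ε * ‖w‖) (hSε : ∀ b w, ‖S b w - w‖ ≤ ε * ‖w‖)
    (hRε' : ∀ (x : TSite d P) (lam μ : Fin d) (w : W), ‖R (unshift lam x, μ) w - R (x, μ) w‖ ≤ ε' * ‖w‖)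
    (A : Bond d P → W) (y : TSite d P)
    (hA1 : ∀ lam μ ν : Fin d, ‖A (shift μ (unshift lam y), ν)‖ ≤ M₀)
    (hD1 : ∀ lam μ ν : Fin d, ‖covGrad c (fun _ : Bond d P => (LinearMap.id : W →ₗ[ℂ] W)) A ((unshift lam y, μ), ν)‖ ≤ M₁)
    (hD2 : ∀ lam μ ν : Fin d, ‖covGrad c (fun _ : Bond d P => (LinearMap.id : W →ₗ[ℂ] W)) A ((shift μ (unshift lam y), lam), ν)‖ ≤ M₁)
    (κ : Fin d) :
    ‖covLapPrincipal c R S A (y, κ) - covLapPrincipal c (fun _ : Bond d P => (LinearMap.id : W →ₗ[ℂ] W)) (fun _ => LinearMap.id) A (y, κ)‖ ≤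
      4 * (Fintype.card (DirPair d) : ℝ) * ((‖c‖ ^ 2 * ε ^ 2 + ‖c‖ ^ 2 * ε') * M₀ + 2 * (‖c‖ * ε) * M₁) := by
  classical
  have hc0 : 0 ≤ ‖c‖ := norm_nonneg c
  set q : Plaq d P → W := covCurl c R A - covCurl c (fun _ : Bond d P => (LinearMap.id : W →ₗ[ℂ] W)) A with hq
  have hq_apply : ∀ p, q p = covCurl c R A p - covCurl c (fun _ : Bond d P => (LinearMap.id : W →ₗ[ℂ] W)) A p := fun p => rfl
  -- sizes of `q` at the plaquettes `p_q(y − e_λ)`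
  have hqn : ∀ (lam : Fin d) (r : DirPair d), ‖q (unshift lam y, r)‖ ≤ ‖c‖ * (ε * (M₀ + M₀)) := fun lam r => by
    rw [hq_apply]
    exact (norm_covCurl_sub_flat_apply_le c R hRε A _ r).trans
      (mul_le_mul_of_nonneg_left (mul_le_mul_of_nonneg_left (add_le_add (hA1 _ _ _) (hA1 _ _ _)) hε) hc0)
  -- sizes of the Leibniz differences
  have hqd : ∀ (lam : Fin d) (r : DirPair d), ‖q (unshift lam y, r) - q (y, r)‖ ≤ ‖c‖ * (ε' * (M₀ + M₀)) + ε * (M₁ + M₁) := fun lam r => by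
    rw [hq_apply, hq_apply]
    exact (norm_q_unshift_sub_q_le c R hc hRε hRε' A y lam r).trans (add_le_add
      (mul_le_mul_of_nonneg_left (mul_le_mul_of_nonneg_left (add_le_add (hA1 _ _ _) (hA1 _ _ _)) hε') hc0)
      (mul_le_mul_of_nonneg_left (add_le_add (hD2 _ _ _) (hD2 _ _ _)) hε))
  -- sizes of the flat curl
  have hcurl : ∀ (x : TSite d P) (r : DirPair d), (∀ μ ν, ‖covGrad c (fun _ : Bond d P => (LinearMap.id : W →ₗ[ℂ] W)) A ((x, μ), ν)‖ ≤ M₁) →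
      ‖covCurl c (fun _ : Bond d P => (LinearMap.id : W →ₗ[ℂ] W)) A (x, r)‖ ≤ M₁ + M₁ := fun x r h => by
    rw [B9Eq34CovCurlVector.covCurl_apply]
    exact (norm_sub_le _ _).trans (add_le_add (h _ _) (h _ _))
  -- term (b): `D*_S q`
  have hb : ‖covCoCurl c S q (y, κ)‖ ≤ ‖c‖ * ∑ _r : DirPair d, 2 * (ε * (‖c‖ * (ε * (M₀ + M₀))) + (‖c‖ * (ε' * (M₀ + M₀)) + ε * (M₁ + M₁))) := by
    refine (norm_covCoCurl_apply_le_leibniz c S hSε hε q y κ).trans (mul_le_mul_of_nonneg_left (Finset.sum_le_sum fun r _ => ?_) hc0)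
    have h1 := add_le_add (mul_le_mul_of_nonneg_left (hqn r.1.1 r) hε) (hqd r.1.1 r)
    have h2 := add_le_add (mul_le_mul_of_nonneg_left (hqn r.1.2 r) hε) (hqd r.1.2 r)
    linarith
  -- term (a): `(D*_S − D*_1)(D_1 A)`
  have ha : ‖covCoCurl c S (covCurl c (fun _ : Bond d P => (LinearMap.id : W →ₗ[ℂ] W)) A) (y, κ) -
      covCoCurl c (fun _ : Bond d P => (LinearMap.id : W →ₗ[ℂ] W)) (covCurl c (fun _ : Bond d P => (LinearMap.id : W →ₗ[ℂ] W)) A) (y, κ)‖ ≤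
      ‖c‖ * (ε * ∑ _r : DirPair d, ((M₁ + M₁) + (M₁ + M₁))) := by
    refine (norm_covCoCurl_sub_flat_apply_le c S hSε hε _ y κ).trans
      (mul_le_mul_of_nonneg_left (mul_le_mul_of_nonneg_left (Finset.sum_le_sum fun r _ => add_le_add ?_ ?_) hε) hc0)
    · exact hcurl _ r (hD1 r.1.1)
    · exact hcurl _ r (hD1 r.1.2)
  rw [covLapPrincipal_sub_flat_eq, ← hq]
  refine (norm_add_le _ _).trans ((add_le_add hb ha).trans (le_of_eq ?_))
  simp only [Finset.sum_const, Finset.card_univ, nsmul_eq_mul]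
  ring

end Split

end Literature.MathematicalPhysics.QuantumFieldTheory.Balaban1983to89.B9Eq371BondPrincipalTwoBackgroundSplit

end
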